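import Summits.CriticalPhenomena.PercolationContinuityZ3.Theorems.PercNearOneGluingNoHeavyQuantTwoPointPairRoutePowerLaw
import Summits.CriticalPhenomena.PercolationContinuityZ3.Theorems.PercNearOneGluingNoHeavyQuantTwoPointPowerLawFreeEpsModulus
import Summits.CriticalPhenomena.PercolationContinuityZ3.Theorems.PercNearOneGluingNoHeavyQuantDktWindowNumerals
import HarnessLib

/-!
# QUANT lane / PAPER-2 rate track (ARM-2, gen 9): THE PAIR ROUTE ON `ℤ³` IN NUMERALS — `π_{p_c(ℤ³)}(n) ≤ (2^150 + 3√C)·n^{−min(b,1)/40}`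
# under pointwise two-point decay, and the (T2) companion `θ(p) ≤ 2^312 (C+1) (p − p_c)^{2b′/(120−b′)}`

builds on p205010 (kernel theorem, internal audit signed; external expert review pending)

Cell `prim-quant`, seat `prim-quant-arm-2` (constants bookkeeper), memo `RATE-CONSTANTS.md` §5.4.  Proof-only numerals file on top of
`…QuantTwoPointPairRoutePowerLaw.lean` (`Quant.oneArmPolyDecayAtCritical_of_pointwiseTwoPoint_pair`: exponent `min(b,1)/(12d+4)`, constant
`195^c·(2√C + K_d)`) with `κ_3 = aknKappa 3 (1/6) ≤ 2^411` (`…QuantDktWindowNumerals`): `K_3 = (20√2·81·40·5^8·κ_3)^{1/3} ≤ 2^149`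
(`Quant.pairConst_three_le`), `195^c ≤ 6/5` for `c ≤ 1/40`, hence the registry row
**`OneArmPolyDecayAtCritical 3 (min(b,1)/40) (2^150 + 3√C)`** (`Quant.oneArmPolyDecayAtCritical_Z3_of_pointwiseTwoPoint_pair`), the printed
sentence `Quant.oneArm_powerLaw_Z3_of_pointwiseTwoPoint_pair`, and through the lane's Newman/two-box transfer
(`thetaHolder_Z3_of_oneArmPolyDecay_numeral'`, `c = b′/40 ≤ 1/4`) the Hölder companion
**`ThetaHolderNearCritical 3 (2b′/(120 − b′)) (2^312 (C+1))`** (`Quant.thetaHolder_Z3_of_pointwiseTwoPoint_pair`; exponent `2/119` at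
`b′ = 1` against `2/1319` for the packaged zone and `2/749` for the free-ε zone).  COMPARISON (conditional rows of the lane, `ℤ³`,
pointwise hypothesis `τ_{p_c}(0,x) ≤ C‖x‖^{−b}`, `b′ = min(b,1)`): packaged zone `2^11 √(2C+1)·n^{−b′/440}` (kick-in `n ≈ 2^{4840/b′}`);
pair route `(2^150 + 3√C)·n^{−b′/40}` (kick-in `n ≈ 2^{6000/b′}`); the two cross at `n ≈ 2^{6100/b′}`, beyond which the pair route is
smaller by the factor `n^{−b′/44}`.  HONEST FRAMING: implications from an OPEN input (pointwise two-point decay at `p_c(ℤ³)`, `b ≈ 0.95`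
numerically, open in print); class log*, display `1 − 2⁻¹⁹⁸⁶`, honest sentence UNCHANGED.
[cite: Cerf2015, Prop. 5.2, Lemma 7.1 and §10] [cite: DuminilcopinKozmaTassion2020, §7 (38)–(39)] [cite: HeydenreichVanDerHofstad2017, Open Problem 10.1]
[cite: Newman1987BetaDelta, Theorem (β ≥ 2/δ)]
-/

noncomputable section

namespace Summit.CriticalPhenomena.PercolationContinuityZ3.Theorems.Quant

open MeasureTheory Literature.Probability.Percolation Literature.Probability.LatticeModels
open Summit.CriticalPhenomena.PercolationContinuityZ3.Theorems.SurfaceTension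
open Literature.Probability.Percolation.AKN
open scoped Classical

/-! ## `ℤ³` in numerals: exponent `min(b,1)/40`, constant `2^150 + 3√C` -/

/-- The pair-route constant on `ℤ³`: `K_3 = (20√2·81·40·5^8·κ_3)^{1/3} ≤ 2^149` (`κ_3 = aknKappa 3 (1/6) ≤ 2^411`, `…QuantDktWindowNumerals`;
`20·(3/2)·81·40·5^8 ≤ 2^36`). [cite: Cerf2015, Prop. 5.2] [cite: DuminilcopinKozmaTassion2020, §7 (38)] -/
theorem pairConst_three_le :
    (20 * Real.sqrt 2 * (((3 : ℕ) : ℝ)) ^ 4 * (12 * (((3 : ℕ) : ℝ)) + 4) * 5 ^ (3 * 3 - 1) *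
        aknKappa 3 (1 / (2 * (((3 : ℕ) : ℝ))))) ^ (1 / 3 : ℝ) ≤ (2 : ℝ) ^ (149 : ℕ) := by
  have hsix : (1 / (2 * (((3 : ℕ) : ℝ))) : ℝ) = 1 / 6 := by norm_num
  rw [hsix]
  have hκ := aknKappa_three_sixth_le
  have hκ0 : 0 ≤ aknKappa 3 (1 / 6) := le_trans (by norm_num) (three_le_aknKappa 3 _)
  have hs2 : Real.sqrt 2 ≤ 3 / 2 := by
    rw [show (3 / 2 : ℝ) = Real.sqrt ((3 / 2) ^ 2) by rw [Real.sqrt_sq (by norm_num)]]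
    exact Real.sqrt_le_sqrt (by norm_num)
  have hs0 : 0 ≤ Real.sqrt 2 := Real.sqrt_nonneg 2
  set K3 : ℝ := 20 * Real.sqrt 2 * (((3 : ℕ) : ℝ)) ^ 4 * (12 * (((3 : ℕ) : ℝ)) + 4) * 5 ^ (3 * 3 - 1) * aknKappa 3 (1 / 6)
    with hK3
  have hK3le : K3 ≤ (2 : ℝ) ^ (447 : ℕ) := by
    have e8 : 3 * 3 - 1 = 8 := by norm_num
    have h1 : K3 = (20 * 81 * 40 * 5 ^ 8) * Real.sqrt 2 * aknKappa 3 (1 / 6) := by rw [hK3, e8]; push_cast; ring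
    rw [h1]
    calc (20 * 81 * 40 * 5 ^ 8 : ℝ) * Real.sqrt 2 * aknKappa 3 (1 / 6) ≤ (20 * 81 * 40 * 5 ^ 8) * (3 / 2) * (2 : ℝ) ^ 411 :=
          mul_le_mul (mul_le_mul_of_nonneg_left hs2 (by norm_num)) hκ hκ0 (by positivity)
      _ ≤ (2 : ℝ) ^ (36 : ℕ) * (2 : ℝ) ^ 411 := mul_le_mul_of_nonneg_right (by norm_num) (by positivity)
      _ = (2 : ℝ) ^ (447 : ℕ) := by rw [← pow_add]
  have hK30 : 0 ≤ K3 := by rw [hK3]; exact mul_nonneg (by positivity) hκ0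
  have h2 : ((2 : ℝ) ^ (447 : ℕ)) ^ (1 / 3 : ℝ) = (2 : ℝ) ^ (149 : ℕ) := by
    rw [show ((2 : ℝ) ^ (447 : ℕ)) = ((2 : ℝ) ^ (149 : ℕ)) ^ (3 : ℕ) by rw [← pow_mul], ← Real.rpow_natCast ((2 : ℝ) ^ (149 : ℕ)) 3,
      ← Real.rpow_mul (by positivity)]
    norm_num
  calc K3 ^ (1 / 3 : ℝ) ≤ ((2 : ℝ) ^ (447 : ℕ)) ^ (1 / 3 : ℝ) := Real.rpow_le_rpow hK30 hK3le (by norm_num)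
    _ = (2 : ℝ) ^ (149 : ℕ) := h2

/-- `195^c ≤ 6/5` for `0 ≤ c ≤ 1/40` (`195 ≤ 2^8`, `2^{1/5} ≤ 6/5`). [folklore] -/
theorem rpow_195_le {c : ℝ} (hc0 : 0 ≤ c) (hc : c ≤ 1 / 40) : (195 : ℝ) ^ c ≤ 6 / 5 := by
  have h1 : (195 : ℝ) ^ c ≤ (256 : ℝ) ^ c := Real.rpow_le_rpow (by norm_num) (by norm_num) hc0
  have h2 : (256 : ℝ) ^ c ≤ (256 : ℝ) ^ (1 / 40 : ℝ) := Real.rpow_le_rpow_of_exponent_le (by norm_num) hc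
  have h3 : (256 : ℝ) ^ (1 / 40 : ℝ) ≤ 6 / 5 := by
    have h4 : ((256 : ℝ) ^ (1 / 40 : ℝ)) ^ 40 = 256 := by
      rw [← Real.rpow_natCast, ← Real.rpow_mul (by norm_num)]; norm_num
    refine le_of_pow_le_pow_left' (k := 40) (by norm_num) (by norm_num) ?_
    rw [h4]; norm_num
  linarith

/-- **THE PAIR ROUTE ON `ℤ³` (registry form).**  `τ_{p_c}(0,x) ≤ C‖x‖^{−b}` (`x ≠ 0`, `b > 0`) ⟹
`OneArmPolyDecayAtCritical 3 (min(b,1)/40) (2^150 + 3√C)` — exponent `1/40` per unit of `min(b,1)` (tree: `1/440` pointwise row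
`…_of_pointwiseTwoPoint_window`, `1/250` ball row `…_freeEps`).
builds on p205010 (kernel theorem, internal audit signed; external expert review pending).
[cite: Cerf2015, Prop. 5.2, Lemma 7.1 and §10] [cite: DuminilcopinKozmaTassion2020, §7 (38)–(39)] [cite: HeydenreichVanDerHofstad2017, Open Problem 10.1] -/
theorem oneArmPolyDecayAtCritical_Z3_of_pointwiseTwoPoint_pair {b C : ℝ} (hb0 : 0 < b)
    (hτ : ∀ x : Site 3, x ≠ 0 → tau 3 (criticalProbI 3) 0 x ≤ C * ‖x‖ ^ (-b)) :
    OneArmPolyDecayAtCritical 3 (min b 1 / 40) ((2 : ℝ) ^ (150 : ℕ) + 3 * Real.sqrt C) := by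
  have h := oneArmPolyDecayAtCritical_of_pointwiseTwoPoint_pair (d := 3) (by norm_num) hb0 hτ
  have h40 : (12 * (((3 : ℕ) : ℝ)) + 4) = 40 := by norm_num
  have hexp : min b 1 / (12 * (((3 : ℕ) : ℝ)) + 4) = min b 1 / 40 := by rw [h40]
  rw [hexp] at h
  refine oneArmPolyDecayAtCritical_const_mono h ?_
  have hK := pairConst_three_le
  have hc0 : 0 ≤ min b 1 / 40 := by have := lt_min hb0 one_pos; positivity
  have hc1 : min b 1 / 40 ≤ 1 / 40 := by have := min_le_right b 1; linarith
  have h195 := rpow_195_le hc0 hc1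
  have hsC : 0 ≤ Real.sqrt C := Real.sqrt_nonneg C
  have hK0 : 0 ≤ (20 * Real.sqrt 2 * (((3 : ℕ) : ℝ)) ^ 4 * (12 * (((3 : ℕ) : ℝ)) + 4) * 5 ^ (3 * 3 - 1) *
      aknKappa 3 (1 / (2 * (((3 : ℕ) : ℝ))))) ^ (1 / 3 : ℝ) :=
    Real.rpow_nonneg (mul_nonneg (by positivity) (le_trans (by norm_num) (three_le_aknKappa 3 _))) _
  have h0 : 0 ≤ (195 : ℝ) ^ (min b 1 / 40) := Real.rpow_nonneg (by norm_num) _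
  calc (195 : ℝ) ^ (min b 1 / 40) * (2 * Real.sqrt C + (20 * Real.sqrt 2 * (((3 : ℕ) : ℝ)) ^ 4 *
          (12 * (((3 : ℕ) : ℝ)) + 4) * 5 ^ (3 * 3 - 1) * aknKappa 3 (1 / (2 * (((3 : ℕ) : ℝ))))) ^ (1 / 3 : ℝ))
      ≤ (6 / 5) * (2 * Real.sqrt C + (2 : ℝ) ^ (149 : ℕ)) :=
        mul_le_mul h195 (by linarith) (by positivity) (by norm_num)
    _ ≤ (2 : ℝ) ^ (150 : ℕ) + 3 * Real.sqrt C := by nlinarith only [hsC]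

/-- **THE PRINTED CONDITIONAL POWER LAW ON `ℤ³`, PAIR ROUTE.**  IF `P_{p_c}(0 ↔ x) ≤ C‖x‖_∞^{−b}` for all `x ≠ 0` with `b > 0`, THEN for every
`n ≥ 1`:  **`π_{p_c(ℤ³)}(n) ≤ (2^150 + 3√C) · n^{−min(b,1)/40}`** (exponent `b′/40` against `b′/440` through the uniqueness zone).
builds on p205010 (kernel theorem, internal audit signed; external expert review pending).
[cite: Cerf2015, Prop. 5.2, Lemma 7.1 and §10] [cite: DuminilcopinKozmaTassion2020, §7 (38)–(39)] [cite: HeydenreichVanDerHofstad2017, Open Problem 10.1] -/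
theorem oneArm_powerLaw_Z3_of_pointwiseTwoPoint_pair {b C : ℝ} (hb0 : 0 < b)
    (hτ : ∀ x : Site 3, x ≠ 0 → (bondPercolation (zdGraph 3) (criticalProbI 3)).real (openConn 0 x) ≤ C * ‖x‖ ^ (-b)) :
    ∀ n : ℕ, 1 ≤ n → oneArmProb 3 (criticalProbI 3) n ≤ ((2 : ℝ) ^ (150 : ℕ) + 3 * Real.sqrt C) * (n : ℝ) ^ (-(min b 1 / 40)) :=
  fun n hn => oneArmPolyDecayAtCritical_Z3_of_pointwiseTwoPoint_pair hb0 hτ n hn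

/-! ## (T2) companion on `ℤ³` -/

/-- **(T2) OF THE PAIR ROUTE ON `ℤ³`**: `τ_{p_c}(0,x) ≤ C‖x‖^{−b}` (`x ≠ 0`, `b > 0`) ⟹
`ThetaHolderNearCritical 3 (2b′/(120 − b′)) (2^312 (C+1))`, `b′ = min(b,1)`, i.e. **`θ(p) ≤ 2^312 (C+1) (p − p_c)^{2b′/(120−b′)}`** —
the lane's Newman/two-box transfer `thetaHolder_Z3_of_oneArmPolyDecay_numeral'` (`c = b′/40 ≤ 1/4`) applied to the pair-route row;
exponent `2/119` at `b′ = 1` against `2/1319` (packaged zone) and `2/749` (free-ε zone).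
builds on p205010 (kernel theorem, internal audit signed; external expert review pending).
[cite: Newman1987BetaDelta, Theorem (β ≥ 2/δ)] [cite: Cerf2015, Lemma 7.1 and §10] [cite: DuminilcopinKozmaTassion2020, §7 (38)] -/
theorem thetaHolder_Z3_of_pointwiseTwoPoint_pair {b C : ℝ} (hb0 : 0 < b)
    (hτ : ∀ x : Site 3, x ≠ 0 → tau 3 (criticalProbI 3) 0 x ≤ C * ‖x‖ ^ (-b)) :
    ThetaHolderNearCritical 3 (2 * min b 1 / (120 - min b 1)) ((2 : ℝ) ^ (312 : ℕ) * (C + 1)) := by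
  have hC0 : 0 ≤ C := const_nonneg_of_pointwiseTwoPoint (d := 3) (by norm_num) _ hτ
  have h1 := oneArmPolyDecayAtCritical_Z3_of_pointwiseTwoPoint_pair hb0 hτ
  have hc0 : 0 < min b 1 / 40 := by have := lt_min hb0 one_pos; positivity
  have hc : min b 1 / 40 ≤ 1 / 4 := by have := min_le_right b 1; linarith
  have hC' : 0 ≤ (2 : ℝ) ^ (150 : ℕ) + 3 * Real.sqrt C := by positivity
  have h2 := thetaHolder_Z3_of_oneArmPolyDecay_numeral' hc0 hc hC' h1
  have hexp : 2 * (min b 1 / 40) / (((3 : ℕ) : ℝ) - min b 1 / 40) = 2 * min b 1 / (120 - min b 1) := by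
    have key : (((3 : ℕ) : ℝ) - min b 1 / 40) = (120 - min b 1) / 40 := by push_cast; ring
    rw [key, div_div_eq_mul_div]
    congr 1; ring
  rw [hexp] at h2
  refine thetaHolderNearCritical_const_mono h2 ?_
  -- `16(2C′ + 125 + 108C′²) + 2 ≤ 2^312 (C+1)` with `C′ = A + 3s`, `A = 2^150`, `s = √C`, `s² = C`, `2^312 = 2^12 A²`
  have hs := Real.sq_sqrt hC0
  set s := Real.sqrt C with hsdef
  have hsC : 0 ≤ s := Real.sqrt_nonneg C
  have h312 : (2 : ℝ) ^ (312 : ℕ) = (2 : ℝ) ^ (12 : ℕ) * ((2 : ℝ) ^ (150 : ℕ)) ^ 2 := by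
    rw [← pow_mul, ← pow_add]
  rw [h312, ← hs]
  generalize hA : (2 : ℝ) ^ (150 : ℕ) = A
  have hA16 : 16 ≤ A := by rw [← hA]; norm_num
  have hA2 : 256 ≤ A ^ 2 := by nlinarith [hA16]
  have hAs : 6 * A * s ≤ A ^ 2 + 9 * s ^ 2 := by nlinarith [sq_nonneg (A - 3 * s)]
  have hB : 6 * s ≤ 3 * s ^ 2 + 3 := by nlinarith [sq_nonneg (s - 1)]
  have hP : 256 * s ^ 2 ≤ A ^ 2 * s ^ 2 := mul_le_mul_of_nonneg_right hA2 (sq_nonneg s)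
  have hQ : 32 * A ≤ 2 * A ^ 2 := by nlinarith [hA16]
  have h12 : (2 : ℝ) ^ (12 : ℕ) = 4096 := by norm_num
  rw [h12]
  nlinarith [hAs, hB, hP, hQ, hA2, sq_nonneg s]

end Summit.CriticalPhenomena.PercolationContinuityZ3.Theorems.Quant

end
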